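import Summits.BirchSwinnertonDyer.BirchSwinnertonDyer.Theorems.ByReductionTypeAtTwoOrdKatoHalfAtTwoIsoRelaxedGenuineOptimal

/-!
# Cert39b (re-typed, GEN 41) — crux `OrdKatoHalfAtTwoIso` (stmt-BirchSwinnertonDyer-19573), line `steinberg-fibre-at-two`:
# the ∃-MEMBER FLAT relaxed text R-opt∃♭ on the `ρ̄₂`-NOT-onto cell, its one-curve door in NÉRON currency, the UNCUT B7 door,
# «R-opt + AU + Mod ⇒ R-opt∃♭», and the crux BY NAME (refuter-grade certificate; nothing asserted, nothing landed)

Seat `cruxtriage-stmt-BirchSwinnertonDyer-19573-2` (crux-triage round 1, seat 2, GEN 41). This file RE-TYPES the GEN 39 certificate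
`Cert39b.lean` (item evidence #45 of 08:46Z, farm rc 0 there), whose verbatim text is not readable from prover jails (lead g8 ASK
09:40Z, RC-434): `run/gate/evidence/` is not mounted and the GEN 39 session folder is gone. The text below is reconstructed from
TRIAGE-r1-2 GEN 39 §A(ii)/§B/§D (s93″) and GEN 40 §D and checked on the farm; binder order follows the tree's R-opt
(`RelaxedZetaColemanIotaOptimalAtTwo`, p706741) and B7 (`KatoMuPartAtOptimalMemberOfNotSurjectiveTwo`).

HONEST FRAMING (cell bsd-2adic): BSD is not proved by any of this; the crux, B7, B7′ (child 23921) and 24097 are NOT proved here; ONE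
`def` of an OPEN memo-tier statement (R-opt∃♭, nothing asserted; to be homed Theorems-side by the one writer w2 / lead as
`@[conjecture] def RelaxedZetaOptimalAtTwoExistsMemberFlat`) + CONDITIONAL doors.

* §1 TEXT **R-opt∃♭** `RelaxedZetaOptimalAtTwoExistsMemberFlat`: for every non-CM globally minimal `W`, good ordinary at `2`, `ρ̄_{W,2}`
  NOT onto, there IS an isogenous globally minimal member `W₁` carrying (a) the FLAT (span-free) relaxed-at-`∞` Coleman package in
  NÉRON currency — for every newform `f` of `W₁`, the cyclotomic `(κ, γ)`, every `ϖ` with `ϖ·Ω_{W₁} = Ω⁺_f`, every relaxed Selmer dual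
  datum `Dr` and relaxed fine datum `Yr` of `W₁`: an ideal `P ⊆ Λ`, `M ⊆ P`, an `ι`-semilinear `τ : P → X^{rel}` killing `M`, exact
  `τ, π` with `π : X^{rel} ↠ X₀^{rel}`, and the image clause `s·(2^{[0<Δ_{W₁}]}·L₀) ∈ M` (`s ∉ (2)`) for EVERY `L₀ ∈ Λ` with
  `ι L₀ = ϖ·L₂(f, α_{W₁})` — and (b) such an integral `L₀` exists (clause (b) of B7 verbatim). MEMO witness: `W₁ := E• = E₀/C₀`
  (the Kato-optimal member, `T₂E•(−1) = V_{ℤ₂}(f)`; [Wuthrich 2014 Prop. 8 + p. 389] at `p = 2` via the odd `X₁`-Manin constant),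
  `P` = Coleman image, `M = ℓ(Λ·z_{γ⁺})`, `τ` = Poitou–Tate column, booking by Kato 12.5/12.6 + 17.5 + 17.11 + (1.3) at `E•`;
  MEMO-EXACT on 394/394 census classes (kit j328846, law M40: LOSS(E•) = 0). TRUE under IMC(`E₀`) + `𝐇¹` free. NOT in print at 2.
* §2 `katoMuPartAtTwo_of_relaxedColemanNeron` — `X5.O1.KatoMuPartAtTwo W′` at ONE curve from relaxed data whose image clause is keyed
  to `L₀` (Néron currency) + relaxed (A₂); NO «`0 ≤ ord₂ ϖ`» hypothesis (contrast `katoMuPartAtTwo_of_relaxedColeman_of_integralRatio`).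
* §3 `relaxedData_of_package_of_arch` — w2's `relaxedColemanData_of_package_of_arch` with the image clause over an arbitrary
  predicate `Φ` on `Λ`.
* §4 **`katoMuPartAtOptimalMember_of_existsMemberFlat_of_arch` : Lim@2-up → FW → R-opt∃♭ → Aʳ → B7 UNCUT** (NO Abbes–Ullmo, NO
  modularity, NO Greenberg 5.14@2) and the child 23921 `OrdKatoMuPartOptimalAtTwo` BY NAME.
* §5 `existsMemberFlat_of_relaxedZetaOptimal_of_AU_of_Mod` : AU → Mod → R-opt → R-opt∃♭ (`W₁ := W₀`, `M := ℓ(Z)`, `L₀ = ϖ₀·G₁` with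
  `ϖ₀ ∈ ℤ₂` by Abbes–Ullmo at `W₀`) — the ∃-member text is formally WEAKER than the registered-road input R-opt.
* §6 the crux BY NAME: `ordKatoHalfAtTwoIso_of_existsMember` (via `…_of_iota_halves_B7`) and the v18 glue shape
  `ordKatoHalfAtTwoIso_v18_existsMember` (via `…_of_iota_halves` with `hbundle`, B7′ := `katoMuPartOff514_of_katoMuPartAtOptimalMember B7`).

References: [Kato2004Asterisque] Thm 12.5, 12.6, 17.4, 17.5, Prop 17.11, §17.13; [Wuthrich2014] Prop. 8, §2.2; [GreenbergLNM1716] §4 Lemma 4.6;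
[Lim2017FineSelmer] Thm 3.5; [FerreroWashington1979]; [AbbesUllmo1996] Thm A; [EdixhovenManin1991] Prop 2; tree p706741 (R-opt), p679274.
-/

set_option autoImplicit false
set_option linter.dupNamespace false

noncomputable section

open scoped Classical MatrixGroups ModularForm NumberField
open CongruenceSubgroup WeierstrassCurve Field IsDedekindDomain NumberField
open Literature.NumberTheory.GaloisRepresentations
open Literature.NumberTheory.GaloisCohomology
open Literature.NumberTheory.EllipticCurves Literature.NumberTheory.EllipticCurves.ModularForms
open Literature.NumberTheory.EllipticCurves.Kato2004
  Literature.NumberTheory.EllipticCurves.Kato2004.EulerSystemValues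
open Literature.NumberTheory.EllipticCurves.Rank1Residual
open Literature.NumberTheory.EllipticCurves.Greenberg1999
open Literature.NumberTheory.IwasawaTheory
open Summit.BirchSwinnertonDyer.BirchSwinnertonDyer.Theorems.Rank1ResidualX1Defs
  Summit.BirchSwinnertonDyer.BirchSwinnertonDyer.Rank1Residual
  Summit.BirchSwinnertonDyer.BirchSwinnertonDyer.Rank1Residual.CoreAssembly
open Summit.BirchSwinnertonDyer.Rank1Residual Summit.BirchSwinnertonDyer.Rank1Residual.X5
  Summit.BirchSwinnertonDyer.Rank1Residual.X1.MuLambda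
open Summit.BirchSwinnertonDyer.BirchSwinnertonDyer.Theorems.OrdKatoOptimalAtTwo
  Summit.BirchSwinnertonDyer.BirchSwinnertonDyer.Theorems.OrdKatoIntAtTwo
open Summit.BirchSwinnertonDyer.BirchSwinnertonDyer.Theses.ByReductionTypeAtTwo
open Summit.BirchSwinnertonDyer.BirchSwinnertonDyer.Theorems.AlignedTransportAtTwoFineRoad
open Summit.BirchSwinnertonDyer.BirchSwinnertonDyer.Theorems.SteinbergFibreAtTwo

namespace Summit.BirchSwinnertonDyer.BirchSwinnertonDyer.Cruxes.OrdKatoHalfAtTwoIso.Cert39b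

/-! ## §1 R-opt∃♭ — the ∃-member FLAT relaxed zeta text in Néron currency (DISPLAYED TEXT; nothing asserted) -/

/-- [MEMO tier, OPEN — a reading, nothing asserted] **R-opt∃♭ — an isogenous MEMBER carrying Kato's relaxed-at-`∞` Coleman package
in NÉRON currency, flat (span-free), on the `ρ̄₂`-NOT-onto good-ordinary non-CM cell.** For every non-CM globally minimal `W`, good
ordinary at `2`, with `ρ̄_{W,2}` NOT onto, there is a `ℚ`-isogenous globally minimal `W₁` such that
(a) for every newform `f` of `W₁` (any level), the cyclotomic `(κ, γ)`, every `ϖ ∈ ℚ` with `ϖ·Ω_{W₁} = Ω⁺_f`, every relaxed Selmer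
dual datum `Dr` (`X^{rel ∞}`) and relaxed fine datum `Yr` (`X₀^{rel ∞}`) of `W₁`: an ideal `P ⊆ Λ`, a submodule `M ⊆ P`, an
`ι`-semilinear column map `τ : P → X^{rel}` killing `M`, `π : X^{rel} ↠ X₀^{rel}` onto and exact after `τ`, and the IMAGE CLAUSE
`s·(2^e·L₀) ∈ M` (`s ∉ (2)`, `e = 1` if `0 < Δ_{W₁}`, `e = 0` if `Δ_{W₁} < 0`) for EVERY `L₀ ∈ Λ` with `ι L₀ = ϖ·L₂(f, α_{W₁})`;
(b) for the newform of level `N_{W₁}` and every such `ϖ` an integral `L₀` exists (clause (b) of B7 verbatim).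
Memo witness: `W₁ := E•` (Kato-optimal member, `T₂E•(−1) = V_{ℤ₂}(f)`, `E• = E₀/C₀`), `P` = Coleman image, `M = ℓ(Λ z_{γ⁺})`,
`τ` = the Poitou–Tate column into `X^{rel ∞}(E•)`, booking `2^{[0<Δ(E•)]}·L₀` by Kato 12.6 + 17.5 + 17.11 + (1.3) at `E•`
(LOSS(E•) = 0, law M40; census kit j328846: memo-exact on 394/394 classes). TRUE under IMC(E₀) + `𝐇¹` free of rank one. NOT in print
at `p = 2`; NOT a Literature fact; nothing asserted.
[cite: Kato2004Asterisque, Thm. 12.6 (p. 222), Thm. 17.4 (1)(2) (p. 273), 17.5, Prop. 17.11 (p. 277), §17.13 (pp. 279–280) (shape only; nothing asserted)]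
[cite: Wuthrich2014, Prop. 8 and §2.2 (p. 388–389) (the lattice L̂_f; shape only)] -/
def RelaxedZetaOptimalAtTwoExistsMemberFlat : Prop :=
  ∀ (W : WeierstrassCurve ℚ) [W.IsElliptic] [W.IsGloballyMinimal],
    ¬ W.HasCM → GoodOrd W 2 → ¬ W.HasSurjectiveModNGaloisRep 2 →
    ∃ (W₁ : WeierstrassCurve ℚ) (_ : W₁.IsElliptic) (_ : W₁.IsGloballyMinimal),
      WeierstrassCurve.IsIsogenous W W₁ ∧
      (∀ {N : ℕ} [NeZero N] (f : CuspForm (Gamma0 N) 2) (κ : ZpExtension ℚ 2) (γ : absoluteGaloisGroup ℚ),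
        κ.IsCyclotomic → κ.IsTopGenerator γ → IsCyclotomicVariable 2 γ → IsNewformOf W₁ f →
        ∀ ϖ : ℚ, (ϖ : ℝ) * W₁.realPeriodRat = plusPeriod f →
        ∀ (Dr : W₁.SelmerDualDataRelaxedInf κ γ) (Yr : W₁.FineSelmerDualDataRelaxedInf κ γ),
          ∃ (P : Submodule (IwasawaAlgebra 2) (IwasawaAlgebra 2)) (M : Submodule (IwasawaAlgebra 2) P)
            (τ : P →ₛₗ[((IwasawaAlgebra.involEquiv 2).toRingEquiv : IwasawaAlgebra 2 →+* IwasawaAlgebra 2)] Dr.X)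
            (π : Dr.X →ₗ[IwasawaAlgebra 2] Yr.X),
            (∀ m ∈ M, τ m = 0) ∧ Function.Surjective π ∧ Function.Exact τ π ∧
            ∀ L₀ : IwasawaAlgebra 2,
              iwasawaToPowerSeries 2 L₀ =
                  PowerSeries.C (ϖ : ℚ_[2]) * padicLFunction f (unitRoot W₁ 2 : ℚ_[2]) →
                ∃ s : IwasawaAlgebra 2, s ∉ IwasawaAlgebra.augIdealP 2 ∧
                  s * (PowerSeries.C (((2 : ℕ) : ℤ_[2]) ^ (if 0 < W₁.Δ then 1 else 0)) * L₀) ∈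
                    Submodule.map P.subtype M) ∧
      ∀ [NeZero (W₁.conductorNorm ℤ)] (f : CuspForm (Gamma0 (W₁.conductorNorm ℤ)) 2),
        IsNewformOf W₁ f → ∀ ϖ : ℚ, (ϖ : ℝ) * W₁.realPeriodRat = plusPeriod f →
          ∃ L₀ : IwasawaAlgebra 2, iwasawaToPowerSeries 2 L₀ =
            PowerSeries.C (ϖ : ℚ_[2]) * padicLFunction f (unitRoot W₁ 2 : ℚ_[2])

/-- `RelaxedZetaOptimalAtTwoExistsMemberFlat` unfolds to its displayed body. [folklore] -/
theorem relaxedZetaOptimalAtTwoExistsMemberFlat_iff : RelaxedZetaOptimalAtTwoExistsMemberFlat ↔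
    ∀ (W : WeierstrassCurve ℚ) [W.IsElliptic] [W.IsGloballyMinimal],
    ¬ W.HasCM → GoodOrd W 2 → ¬ W.HasSurjectiveModNGaloisRep 2 →
    ∃ (W₁ : WeierstrassCurve ℚ) (_ : W₁.IsElliptic) (_ : W₁.IsGloballyMinimal),
      WeierstrassCurve.IsIsogenous W W₁ ∧
      (∀ {N : ℕ} [NeZero N] (f : CuspForm (Gamma0 N) 2) (κ : ZpExtension ℚ 2) (γ : absoluteGaloisGroup ℚ),
        κ.IsCyclotomic → κ.IsTopGenerator γ → IsCyclotomicVariable 2 γ → IsNewformOf W₁ f →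
        ∀ ϖ : ℚ, (ϖ : ℝ) * W₁.realPeriodRat = plusPeriod f →
        ∀ (Dr : W₁.SelmerDualDataRelaxedInf κ γ) (Yr : W₁.FineSelmerDualDataRelaxedInf κ γ),
          ∃ (P : Submodule (IwasawaAlgebra 2) (IwasawaAlgebra 2)) (M : Submodule (IwasawaAlgebra 2) P)
            (τ : P →ₛₗ[((IwasawaAlgebra.involEquiv 2).toRingEquiv : IwasawaAlgebra 2 →+* IwasawaAlgebra 2)] Dr.X)
            (π : Dr.X →ₗ[IwasawaAlgebra 2] Yr.X),
            (∀ m ∈ M, τ m = 0) ∧ Function.Surjective π ∧ Function.Exact τ π ∧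
            ∀ L₀ : IwasawaAlgebra 2,
              iwasawaToPowerSeries 2 L₀ =
                  PowerSeries.C (ϖ : ℚ_[2]) * padicLFunction f (unitRoot W₁ 2 : ℚ_[2]) →
                ∃ s : IwasawaAlgebra 2, s ∉ IwasawaAlgebra.augIdealP 2 ∧
                  s * (PowerSeries.C (((2 : ℕ) : ℤ_[2]) ^ (if 0 < W₁.Δ then 1 else 0)) * L₀) ∈
                    Submodule.map P.subtype M) ∧
      ∀ [NeZero (W₁.conductorNorm ℤ)] (f : CuspForm (Gamma0 (W₁.conductorNorm ℤ)) 2),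
        IsNewformOf W₁ f → ∀ ϖ : ℚ, (ϖ : ℝ) * W₁.realPeriodRat = plusPeriod f →
          ∃ L₀ : IwasawaAlgebra 2, iwasawaToPowerSeries 2 L₀ =
            PowerSeries.C (ϖ : ℚ_[2]) * padicLFunction f (unitRoot W₁ 2 : ℚ_[2]) :=
  Iff.rfl

/-! ## §2 The one-curve slack door in NÉRON currency -/

/-- **`X5.O1.KatoMuPartAtTwo W′` at ONE curve from relaxed data booked at `2^e·L₀` (Néron currency) + relaxed (A₂).** For every
newform `f` of `W′`, the cyclotomic `(κ, γ)`, every `ϖ` with `ϖ·Ω_{W′} = Ω⁺_f`, every `D` and `Yr`: SOME relaxed module `Xr` with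
`(θ, P, M, τ, π, e)`, the archimedean clause `ℓ₍₂₎(X) + e ≤ ℓ₍₂₎(Xr)` and the image clause `s·(2^e·L₀) ∈ M` for EVERY `L₀` with
`ι L₀ = ϖ·L₂(f, α)`; plus relaxed (A₂) «`ℓ₍₂₎(X₀^{rel}) = 0`». Then `2^{μ(X)} ∣ L₀`: the slack door
`mu_le_mu_of_relaxedColemanSemilinear_of_arch` at `G := L₀` gives `μ(X) ≤ μ(L₀)`. NO «`0 ≤ ord₂ ϖ`» hypothesis is needed.
[cite: Kato2004Asterisque, §17.13 (pp. 279–280) (shape of the sequence)] [cite: GreenbergLNM1716, §4 Lemma 4.6 (PDF pp. 106–107)] -/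
theorem katoMuPartAtTwo_of_relaxedColemanNeron (W' : WeierstrassCurve ℚ) [W'.IsElliptic] [W'.IsGloballyMinimal]
    (hR : ∀ {N : ℕ} [NeZero N] (f : CuspForm (Gamma0 N) 2) (κ : ZpExtension ℚ 2) (γ : absoluteGaloisGroup ℚ),
      κ.IsCyclotomic → κ.IsTopGenerator γ → IsCyclotomicVariable 2 γ → IsNewformOf W' f →
      ∀ ϖ : ℚ, (ϖ : ℝ) * W'.realPeriodRat = plusPeriod f →
      ∀ (D : W'.SelmerDualData κ γ) (Yr : W'.FineSelmerDualDataRelaxedInf κ γ),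
        ∃ (Xr : Type) (_ : AddCommGroup Xr) (_ : Module (IwasawaAlgebra 2) Xr)
          (θ : IwasawaAlgebra 2 ≃+* IwasawaAlgebra 2) (P : Submodule (IwasawaAlgebra 2) (IwasawaAlgebra 2))
          (M : Submodule (IwasawaAlgebra 2) P)
          (τ : P →ₛₗ[(θ : IwasawaAlgebra 2 →+* IwasawaAlgebra 2)] Xr) (π : Xr →ₗ[IwasawaAlgebra 2] Yr.X) (e : ℕ),
          (∀ m ∈ M, τ m = 0) ∧ Function.Surjective π ∧ Function.Exact τ π ∧
          Module.lengthAt (IwasawaAlgebra 2) D.X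
              ⟨IwasawaAlgebra.augIdealP 2, IwasawaAlgebra.isPrime_augIdealP_holds 2⟩ + e ≤
            Module.lengthAt (IwasawaAlgebra 2) Xr ⟨IwasawaAlgebra.augIdealP 2, IwasawaAlgebra.isPrime_augIdealP_holds 2⟩ ∧
          ∀ L₀ : IwasawaAlgebra 2,
            iwasawaToPowerSeries 2 L₀ = PowerSeries.C (ϖ : ℚ_[2]) * padicLFunction f (unitRoot W' 2 : ℚ_[2]) →
              ∃ s : IwasawaAlgebra 2, s ∉ IwasawaAlgebra.augIdealP 2 ∧
                s * (PowerSeries.C (((2 : ℕ) : ℤ_[2]) ^ e) * L₀) ∈ Submodule.map P.subtype M)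
    (hAr : ∀ (κ : ZpExtension ℚ 2) (γ : absoluteGaloisGroup ℚ), κ.IsCyclotomic → κ.IsTopGenerator γ →
      ∀ Yr : W'.FineSelmerDualDataRelaxedInf κ γ,
        Module.lengthAt (IwasawaAlgebra 2) Yr.X ⟨IwasawaAlgebra.augIdealP 2, IwasawaAlgebra.isPrime_augIdealP_holds 2⟩ = 0) :
    O1.KatoMuPartAtTwo W' := by
  intro κ γ hκ hγ hγ' _ _ f hf ϖ hϖf D L₀ hL₀
  obtain ⟨Yr⟩ := W'.nonempty_fineSelmerDualDataRelaxedInf κ hγ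
  obtain ⟨Xr, _, _, θ, P, M, τ, π, e, hτM, -, hπ, harch, himg⟩ := hR f κ γ hκ hγ hγ' hf ϖ hϖf D Yr
  by_cases hL0 : L₀ = 0
  · rw [hL0]; exact dvd_zero _
  have hμ : D.mu ≤ mu L₀ :=
    mu_le_mu_of_relaxedColemanSemilinear_of_arch (D := D) hL0 θ P M τ π hτM hπ (himg L₀ hL₀) harch (hAr κ γ hκ hγ Yr)
  calc (PowerSeries.C (((2 : ℕ) : ℤ_[2]) ^ D.mu) : IwasawaAlgebra 2)
      ∣ PowerSeries.C (((2 : ℕ) : ℤ_[2]) ^ mu L₀) := map_dvd _ (pow_dvd_pow _ hμ)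
    _ ∣ L₀ := C_pow_mu_dvd hL0

/-! ## §3 Relaxed data at ONE good-ordinary curve from a package with an arbitrary image predicate + Aʳ -/

/-- **The relaxed data of the door at ONE good-ordinary curve `V` from a package whose image clause is keyed to an arbitrary
predicate `Φ` on `Λ`, plus Aʳ** (sign-uniform: `e = 1` with the archimedean `Λ/2 ↪ ker(X^{rel} ↠ X)` if `0 < Δ_V`, `e = 0` and the
trivial archimedean clause if `Δ_V < 0`). w2's `relaxedColemanData_of_package_of_arch` with `Φ L₀ :≡ ι L₀ = ϖ·L₂` in place of
`ι G₁ = L₂`. [cite: GreenbergLNM1716, §4 Lemma 4.6 (PDF pp. 106–107)] -/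
theorem relaxedData_of_package_of_arch (hA : ArchimedeanLambdaModTwoOrdAtTwo)
    (V : WeierstrassCurve ℚ) [V.IsElliptic] [V.IsGloballyMinimal] (hord : IsOrdinaryAt V 2)
    (Φ : IwasawaAlgebra 2 → Prop) {κ : ZpExtension ℚ 2} {γ : absoluteGaloisGroup ℚ} (hκ : κ.IsCyclotomic)
    (hγ : κ.IsTopGenerator γ) (D : V.SelmerDualData κ γ) (Yr : V.FineSelmerDualDataRelaxedInf κ γ)
    (hpack : ∀ Dr : V.SelmerDualDataRelaxedInf κ γ,
      ∃ (P : Submodule (IwasawaAlgebra 2) (IwasawaAlgebra 2)) (M : Submodule (IwasawaAlgebra 2) P)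
        (τ : P →ₛₗ[((IwasawaAlgebra.involEquiv 2).toRingEquiv : IwasawaAlgebra 2 →+* IwasawaAlgebra 2)] Dr.X)
        (π : Dr.X →ₗ[IwasawaAlgebra 2] Yr.X),
        (∀ m ∈ M, τ m = 0) ∧ Function.Surjective π ∧ Function.Exact τ π ∧
        ∀ L₀ : IwasawaAlgebra 2, Φ L₀ →
          ∃ s : IwasawaAlgebra 2, s ∉ IwasawaAlgebra.augIdealP 2 ∧
            s * (PowerSeries.C (((2 : ℕ) : ℤ_[2]) ^ (if 0 < V.Δ then 1 else 0)) * L₀) ∈ Submodule.map P.subtype M) :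
    ∃ (Xr : Type) (_ : AddCommGroup Xr) (_ : Module (IwasawaAlgebra 2) Xr)
      (θ : IwasawaAlgebra 2 ≃+* IwasawaAlgebra 2) (P : Submodule (IwasawaAlgebra 2) (IwasawaAlgebra 2))
      (M : Submodule (IwasawaAlgebra 2) P)
      (τ : P →ₛₗ[(θ : IwasawaAlgebra 2 →+* IwasawaAlgebra 2)] Xr) (π : Xr →ₗ[IwasawaAlgebra 2] Yr.X) (e : ℕ),
      (∀ m ∈ M, τ m = 0) ∧ Function.Surjective π ∧ Function.Exact τ π ∧
      Module.lengthAt (IwasawaAlgebra 2) D.X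
          ⟨IwasawaAlgebra.augIdealP 2, IwasawaAlgebra.isPrime_augIdealP_holds 2⟩ + e ≤
        Module.lengthAt (IwasawaAlgebra 2) Xr ⟨IwasawaAlgebra.augIdealP 2, IwasawaAlgebra.isPrime_augIdealP_holds 2⟩ ∧
      ∀ L₀ : IwasawaAlgebra 2, Φ L₀ →
        ∃ s : IwasawaAlgebra 2, s ∉ IwasawaAlgebra.augIdealP 2 ∧
          s * (PowerSeries.C (((2 : ℕ) : ℤ_[2]) ^ e) * L₀) ∈ Submodule.map P.subtype M := by
  let Dr : V.SelmerDualDataRelaxedInf κ γ := V.selmerDualDataRelaxedInf κ hγ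
  obtain ⟨q, hq⟩ := exists_relaxedSelmerRestrict V κ hγ Dr D
  have hqs := relaxedSelmerRestrict_surjective V κ Dr D q hq
  obtain ⟨P, M, τ, π, hτM, hπs, hπ, himg⟩ := hpack Dr
  refine ⟨Dr.X, inferInstance, inferInstance, (IwasawaAlgebra.involEquiv 2).toRingEquiv, P, M, τ, π,
    (if 0 < V.Δ then 1 else 0), hτM, hπs, hπ, ?_, himg⟩
  by_cases hΔ : 0 < V.Δ
  · obtain ⟨j, hj⟩ := hA V κ γ hκ hord hΔ hγ D Dr q hq
    rw [if_pos hΔ]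
    exact lengthAt_add_one_le_of_archExtension q hqs j hj
  · rw [if_neg hΔ, Nat.cast_zero, add_zero]
    exact Module.lengthAt_le_of_surjective q hqs _

/-! ## §4 B7 UNCUT and the child 23921 BY NAME from R-opt∃♭ + Aʳ + Lim@2 upstairs + Ferrero–Washington -/

/-- **B7 UNCUT `KatoMuPartAtOptimalMemberOfNotSurjectiveTwo` BY NAME ⟸ Lim 2017 Thm 3.5 at `2` UPSTAIRS (print) + Ferrero–Washington
(print) + R-opt∃♭ (memo) + Aʳ (reserve / print-derived).** NO Abbes–Ullmo, NO modularity, NO Greenberg 5.14@2: the witness member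
`W₁` and clause (b) come from R-opt∃♭ itself; clause (a) at `W₁` is §2 with the relaxed data of §3 (package of R-opt∃♭ into the
constructed relaxed datum) and relaxed (A₂) at `W₁` (`W₁` is not onto: `not_hasSurjectiveModNGaloisRep_two_of_isIsogenous`).
CONDITIONAL; nothing closed. [cite: Lim2017FineSelmer, §3 Thm. 3.5 and Lemma 3.2] [cite: FerreroWashington1979, Theorem]
[cite: GreenbergLNM1716, §4 Lemma 4.6 (PDF pp. 106–107)] -/
theorem katoMuPartAtOptimalMember_of_existsMemberFlat_of_arch
    (hLim : Lim2017.thm35_at_two_upstairs_fineSelmer_twoTorsion_finite_of_classicalMuVanishes)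
    (hFW : ferreroWashington1979_classicalMuVanishes)
    (hR : RelaxedZetaOptimalAtTwoExistsMemberFlat) (hA : ArchimedeanLambdaModTwoOrdAtTwo) :
    KatoMuPartAtOptimalMemberOfNotSurjectiveTwo := by
  intro W _ _ hcm hgo hns
  obtain ⟨W₁, _, _, hiso, hpack, hint⟩ := hR W hcm hgo hns
  have hgo₁ : GoodOrd W₁ 2 := goodOrd_two_of_isIsogenous W hiso hgo
  have hns₁ : ¬ W₁.HasSurjectiveModNGaloisRep 2 := not_hasSurjectiveModNGaloisRep_two_of_isIsogenous W hns hiso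
  refine ⟨W₁, ‹_›, ‹_›, hiso, ?_, hint⟩
  refine katoMuPartAtTwo_of_relaxedColemanNeron W₁ (fun f κ γ hκ hγ hγ' hf ϖ hϖ D Yr ↦ ?_)
    (fun κ γ hκ hγ Yr ↦
      lengthAt_fineRelaxed_eq_zero_of_not_hasSurjectiveModNGaloisRep_of_limUpstairs_of_FW hLim hFW W₁ hns₁ hκ hγ Yr)
  exact relaxedData_of_package_of_arch hA W₁ ⟨hgo₁.1, hgo₁.2⟩
    (fun L₀ ↦ iwasawaToPowerSeries 2 L₀ = PowerSeries.C (ϖ : ℚ_[2]) * padicLFunction f (unitRoot W₁ 2 : ℚ_[2]))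
    hκ hγ D Yr (fun Dr ↦ hpack f κ γ hκ hγ hγ' hf ϖ hϖ Dr Yr)

/-- **The route's child `OrdKatoMuPartOptimalAtTwo` (stmt-BirchSwinnertonDyer-23921, text = B7′ verbatim) BY NAME** from the same
four inputs (B7 ⇒ B7′, `katoMuPartOff514_of_katoMuPartAtOptimalMember`, p679274). CONDITIONAL; the item is NOT closed by this.
[cite: Lim2017FineSelmer, §3 Thm. 3.5] [cite: FerreroWashington1979, Theorem] -/
theorem ordKatoMuPartOptimalAtTwo_of_existsMemberFlat_of_arch
    (hLim : Lim2017.thm35_at_two_upstairs_fineSelmer_twoTorsion_finite_of_classicalMuVanishes)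
    (hFW : ferreroWashington1979_classicalMuVanishes)
    (hR : RelaxedZetaOptimalAtTwoExistsMemberFlat) (hA : ArchimedeanLambdaModTwoOrdAtTwo) :
    OrdKatoMuPartOptimalAtTwo :=
  katoMuPartOff514_of_katoMuPartAtOptimalMember (katoMuPartAtOptimalMember_of_existsMemberFlat_of_arch hLim hFW hR hA)

/-! ## §5 R-opt + Abbes–Ullmo + modularity ⇒ R-opt∃♭ (the ∃-member text is formally WEAKER) -/

/-- **R-opt (the registered road's relaxed-genuine input at the lattice-optimal member, p706741) + Abbes–Ullmo + modularity ⇒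
R-opt∃♭**: `W₁ := W₀` (an isogenous lattice-optimal member exists by modularity + Edixhoven, `exists_isIsogenous_latticeOptimal`),
`M := ℓ(Z)` (span clause dropped), and the Néron-currency image clause from the `G₁`-clause because `L₀ = ϖ₀·G₁` with `ϖ₀ ∈ ℤ₂`
(`ord₂ ϖ = 0` at `W₀` by Abbes–Ullmo, `padicValRat_two_neronRatio_eq_zero_of_latticeOptimal_of_abbesUllmo`) and `M` is an ideal;
clause (b) at `W₀` is `hint_two_of_latticeOptimal_of_abbesUllmo`. [cite: AbbesUllmo1996, Thm. A] [cite: EdixhovenManin1991, Prop. 2] -/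
theorem existsMemberFlat_of_relaxedZetaOptimal_of_AU_of_Mod
    (hAU : abbesUllmo_not_dvd_maninConstant_of_not_dvd_level) (hMod : nonempty_modularParametrizationData)
    (hR : RelaxedZetaColemanIotaOptimalAtTwo) : RelaxedZetaOptimalAtTwoExistsMemberFlat := by
  intro W _ _ hcm hgo hns
  obtain ⟨W₀, _, _, N₀, _, D₀, hiso, hopt⟩ := exists_isIsogenous_latticeOptimal hMod W
  haveI : ContinuousSMul ℤ_[2] (W₀.tateModule 2) := TateModule.continuousSMul_padicInt
  haveI : Module.Free ℤ_[2] (W₀.tateModule 2) := W₀.module_free_tateModule_holds 2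
  haveI : Module.Finite ℤ_[2] (W₀.tateModule 2) := W₀.module_finite_tateModule_holds 2
  have hgo₀ : GoodOrd W₀ 2 := goodOrd_two_of_isIsogenous W hiso hgo
  refine ⟨W₀, ‹_›, ‹_›, hiso, fun f κ γ hκ hγ hγ' hf ϖ hϖ Dr Yr ↦ ?_,
    fun f hf ϖ hϖ ↦ hint_two_of_latticeOptimal_of_abbesUllmo hAU W₀ hgo₀ D₀ hopt f hf ϖ hϖ⟩
  obtain ⟨I, Z, P, ℓ, τ, π, -, hτℓ, hπs, hπ, himg⟩ :=
    hR W hcm hgo hns W₀ D₀ hiso hopt f κ γ hκ hγ hγ' hf Dr Yr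
  refine ⟨P, Submodule.map ℓ Z, τ, π, ?_, hπs, hπ, fun L₀ hL₀ ↦ ?_⟩
  · rintro _ ⟨z, hz, rfl⟩
    exact hτℓ z hz
  · obtain ⟨G, hG⟩ := exists_iwasawaToPowerSeries_eq_padicLFunction_two_auto (W := W₀) (f := f) ⟨hgo₀.1, hgo₀.2⟩ hf
    have hval : 0 ≤ padicValRat 2 ϖ :=
      (padicValRat_two_neronRatio_eq_zero_of_latticeOptimal_of_abbesUllmo hAU W₀ hgo₀.1 D₀ hopt f hf ϖ hϖ).ge
    have hnorm : ‖((ϖ : ℚ) : ℚ_[2])‖ ≤ 1 := by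
      by_cases h0 : ϖ = 0
      · subst h0; simp
      have hϖQ : ((ϖ : ℚ) : ℚ_[2]) ≠ 0 := by exact_mod_cast h0
      rw [Padic.norm_eq_zpow_neg_valuation hϖQ, Padic.valuation_ratCast]
      exact zpow_le_one_of_nonpos₀ (by norm_num) (by linarith)
    let ϖ₀ : ℤ_[2] := ⟨((ϖ : ℚ) : ℚ_[2]), hnorm⟩
    have hL₀G : L₀ = (PowerSeries.C ϖ₀ : IwasawaAlgebra 2) * G := by
      apply iwasawaToPowerSeries_injective 2
      rw [hL₀, map_mul, hG, iwasawaToPowerSeries, PowerSeries.map_C]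
      rfl
    obtain ⟨s, hs, hsG⟩ := himg G hG
    refine ⟨s, hs, ?_⟩
    have hrw : s * (PowerSeries.C (((2 : ℕ) : ℤ_[2]) ^ (if 0 < W₀.Δ then 1 else 0)) * L₀) =
        (PowerSeries.C ϖ₀ : IwasawaAlgebra 2) *
          (s * (PowerSeries.C (((2 : ℕ) : ℤ_[2]) ^ (if 0 < W₀.Δ then 1 else 0)) * G)) := by
      rw [hL₀G]; ring
    rw [hrw, ← Submodule.map_comp]
    exact Ideal.mul_mem_left _ _ hsG

/-! ## §6 The crux BY NAME -/

/-- **The crux `OrdKatoHalfAtTwoIso` (stmt-BirchSwinnertonDyer-19573) BY NAME from F1μι⁻ (`Δ < 0`, memo), the direct `0 < Δ` child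
`OrdKatoHalfAtTwoIsoPosDisc` (by name), Abbes–Ullmo, Lim@2 upstairs, Ferrero–Washington, R-opt∃♭, Aʳ and Kato 17.4 (1)(2) at `2`** —
`ordKatoHalfAtTwoIso_of_iota_halves_B7` with B7 := §4. NO Greenberg 5.14@2 and NO modularity on the not-onto road. CONDITIONAL; the
crux is NOT closed by this. [cite: Kato2004Asterisque, Thm. 17.4 (1)(2) (p. 273)] [cite: AbbesUllmo1996, Thm. A] -/
theorem ordKatoHalfAtTwoIso_of_existsMember (hNeg : ZetaColemanMuIotaNegDiscAtTwo) (hPos : OrdKatoHalfAtTwoIsoPosDisc)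
    (hAU : abbesUllmo_not_dvd_maninConstant_of_not_dvd_level)
    (hLim : Lim2017.thm35_at_two_upstairs_fineSelmer_twoTorsion_finite_of_classicalMuVanishes)
    (hFW : ferreroWashington1979_classicalMuVanishes)
    (hR : RelaxedZetaOptimalAtTwoExistsMemberFlat) (hA : ArchimedeanLambdaModTwoOrdAtTwo)
    (h17 : ∀ (V : WeierstrassCurve ℚ) [V.IsElliptic] [V.IsGloballyMinimal] [NeZero (V.conductorNorm ℤ)]
      (f : CuspForm (Gamma0 (V.conductorNorm ℤ)) 2), kato_divisibility_allPrimes V 2 (f := f)) :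
    OrdKatoHalfAtTwoIso :=
  ordKatoHalfAtTwoIso_of_iota_halves_B7 hNeg hPos hAU
    (katoMuPartAtOptimalMember_of_existsMemberFlat_of_arch hLim hFW hR hA) h17

/-- **The v18 glue shape**: the crux BY NAME via the lead's `ordKatoHalfAtTwoIso_of_iota_halves` with the registered bundle
(child 23889: PUB ∧ Abbes–Ullmo ∧ Greenberg 5.14@2 — 5.14@2 consumed only SYNTACTICALLY) and B7′ := B7 ∘ §4
(`katoMuPartOff514_of_katoMuPartAtOptimalMember`). CONDITIONAL; nothing closed. [cite: Kato2004Asterisque, Thm. 17.4 (1)(2) (p. 273)] -/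
theorem ordKatoHalfAtTwoIso_v18_existsMember (hNeg : ZetaColemanMuIotaNegDiscAtTwo) (hPos : OrdKatoHalfAtTwoIsoPosDisc)
    (hbundle : OrdPublishedInputsAtTwo ∧ abbesUllmo_not_dvd_maninConstant_of_not_dvd_level ∧
      Greenberg1999.prop514_isTorsion_mu_eq_zero_two)
    (hLim : Lim2017.thm35_at_two_upstairs_fineSelmer_twoTorsion_finite_of_classicalMuVanishes)
    (hFW : ferreroWashington1979_classicalMuVanishes)
    (hR : RelaxedZetaOptimalAtTwoExistsMemberFlat) (hA : ArchimedeanLambdaModTwoOrdAtTwo) : OrdKatoHalfAtTwoIso :=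
  ordKatoHalfAtTwoIso_of_iota_halves hNeg hPos hbundle
    (katoMuPartOff514_of_katoMuPartAtOptimalMember (katoMuPartAtOptimalMember_of_existsMemberFlat_of_arch hLim hFW hR hA))

/-- Sanity: the §6 conclusion is LITERALLY the route decl. [folklore] -/
example (hNeg : ZetaColemanMuIotaNegDiscAtTwo) (hPos : OrdKatoHalfAtTwoIsoPosDisc)
    (hAU : abbesUllmo_not_dvd_maninConstant_of_not_dvd_level)
    (hLim : Lim2017.thm35_at_two_upstairs_fineSelmer_twoTorsion_finite_of_classicalMuVanishes)
    (hFW : ferreroWashington1979_classicalMuVanishes)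
    (hR : RelaxedZetaOptimalAtTwoExistsMemberFlat) (hA : ArchimedeanLambdaModTwoOrdAtTwo)
    (h17 : ∀ (V : WeierstrassCurve ℚ) [V.IsElliptic] [V.IsGloballyMinimal] [NeZero (V.conductorNorm ℤ)]
      (f : CuspForm (Gamma0 (V.conductorNorm ℤ)) 2), kato_divisibility_allPrimes V 2 (f := f)) :
    Summit.BirchSwinnertonDyer.BirchSwinnertonDyer.Theses.ByReductionTypeAtTwo.OrdKatoHalfAtTwoIso :=
  ordKatoHalfAtTwoIso_of_existsMember hNeg hPos hAU hLim hFW hR hA h17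

end Summit.BirchSwinnertonDyer.BirchSwinnertonDyer.Cruxes.OrdKatoHalfAtTwoIso.Cert39b

end
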